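import Summits.BirchSwinnertonDyer.BirchSwinnertonDyer.Theorems.ManinLocalTwoThreeDiscLevelMinimalResidualSynthesis
import HarnessLib

/-!
# Route `ManinLocalTwoThree` (cell `bsd-f2-manin`), crux C2 `ManinOddAtFour` (stmt-BirchSwinnertonDyer-22967): the
# `S₃ | C₃` SPLIT of the Euler-system certificate on the (odd level, |Δ_min|, level, sign)-minimal residue

The cell's Euler-system lens (MEMO-es §22, es g10, 2026-08-28) now reads the multi-shift generation law E-es-22 as a
THEOREM-candidate on the curves whose mod-`2` image is `S₃` (`W[2]` irreducible and `Δ` NOT a square; modulo the printed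
Ihara fact F-es-28) and as a CONJECTURE — possibly false — on the `C₃`-image curves (`W[2]` irreducible, `Δ` a rational
square; 3 950 optimal classes with `4 ∣ N ≤ 5·10⁵`). A `C₃`-image curve has `Δ > 0`, so it sits inside the archimedean
residual's territory, where the certificate only ever gave `4 ∤ c`. This file records the corresponding four-way split of
crux C2 on this seat's residue (`maninLocalTwoThree_maninOddAtFour_of_discLevelMinimal`, p594896), so that a reshaped line
can register its stubs by name: (S₃) certificate `4 ∤ c`, and `2 ∤ c` if `Δ < 0`, on the irreducible NON-square-`Δ` classes;
(Ra′) `Δ > 0` non-square, `4 ∤ c ⟹ 2 ∤ c`; (C₃) Manin at `2` outright on the irreducible square-`Δ` classes; (Rb) Manin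
at `2` on the `W[2]`-reducible classes — each on the disc-level-minimal classes (seven ¬-clauses). CENSUS (this seat,
TWISTCENSUS2 join, exact `Δ` from the a-invariants; optimal classes `4 ∣ N ≤ 5·10⁵`): residue 220 053 = S₃ with `Δ < 0`
117 714 (decided by the certificate) + Ra′ 47 283 + C₃ 709 (`v₂(N)` 2: 402 · 3: 296 · 5: 11) + Rb 54 347. HONEST FRAMING:
`proof.conditional`; every input is open (Kato fact statement-only, generation law conjectural / fact-dependent,
residuals open). Manin's conjecture at `2` is NOT proved here; nothing about BSD is proved here. Seat bsd-line-manin23-p2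
(gen 3).
-/

set_option autoImplicit false
set_option linter.dupNamespace false

noncomputable section

open scoped Classical MatrixGroups ModularForm

namespace Summit.BirchSwinnertonDyer.BirchSwinnertonDyer.Theorems

open CongruenceSubgroup WeierstrassCurve Literature.NumberTheory.EllipticCurves
  Literature.NumberTheory.EllipticCurves.ModularForms
  Summit.BirchSwinnertonDyer.Rank1Residual.ManinAdditive

/-- **C2 ⟸ (S₃-image certificate) ∧ (Ra′: archimedean residual off the square-`Δ` classes) ∧ (C₃: Manin at `2` on the
irreducible square-`Δ` classes) ∧ (Rb)**, all four on the (odd level, `|Δ_min|`, level, sign)-minimal classes of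
`maninLocalTwoThree_maninOddAtFour_of_discLevelMinimal`. Excluded middle on irreducibility, on `IsSquare W.Δ` and on the
sign of `Δ_W`. [cite: Stevens1989, Lemmas (5.2), (5.4)] [cite: Kato2004Asterisque, Thm. 9.7 (p. 189)] -/
theorem maninLocalTwoThree_maninOddAtFour_of_discLevelMinimal_S3C3Split
    (hS3 : ∀ (W : WeierstrassCurve ℚ) [W.IsElliptic] [W.IsGloballyMinimal] {N : ℕ} [NeZero N]
      (D : ModularParametrizationData W N),
      (∀ z ∈ D.L.lattice, ∃ w ∈ periodLattice D.f, z = D.c * w) → 2 ^ 2 ∣ N →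
      ¬ (∃ (W' : WeierstrassCurve ℚ) (d : ℤ), W'.IsElliptic ∧ W'.IsGloballyMinimal ∧
        (d = -1 ∨ d = 2 ∨ d = -2) ∧ IsIsogenous W (W'.quadraticTwist (d : ℚ)) ∧
        ¬ 2 ^ 2 ∣ W'.conductorNorm ℤ) →
      ¬ (∃ (W' : WeierstrassCurve ℚ) (q : ℕ), W'.IsElliptic ∧ W'.IsGloballyMinimal ∧
        q.Prime ∧ q ≠ 2 ∧ q ^ 2 ∣ N ∧
        IsIsogenous W (W'.quadraticTwist (((-1 : ℤ) ^ (q / 2) * q : ℤ) : ℚ)) ∧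
        ¬ q ^ 2 ∣ W'.conductorNorm ℤ) →
      ¬ (∃ (A : WeierstrassCurve ℚ) (_ : A.IsElliptic) (_ : A.IsGloballyMinimal) (N' : ℕ) (_ : NeZero N')
        (D' : ModularParametrizationData A N'),
        (∀ z ∈ D'.L.lattice, ∃ w ∈ periodLattice D'.f, z = D'.c * w) ∧ 2 ^ 4 ∣ N ∧
        2 ^ 2 ∣ A.conductorNorm ℤ ∧ A.conductorNorm ℤ ∣ N ∧ A.conductorNorm ℤ < N ∧
        IsIsogenous W (A.quadraticTwist ((-1 : ℤ) : ℚ)) ∧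
        A.minimalDiscriminantInt.natAbs ≤ W.minimalDiscriminantInt.natAbs) →
      ¬ (∃ (A : WeierstrassCurve ℚ) (_ : A.IsElliptic) (_ : A.IsGloballyMinimal) (N' : ℕ) (_ : NeZero N')
        (D' : ModularParametrizationData A N') (d : ℤ) (C : WeierstrassCurve ℚ) (u : VariableChange ℚ),
        C.IsElliptic ∧ C.IsGloballyMinimal ∧
        (∀ z ∈ D'.L.lattice, ∃ w ∈ periodLattice D'.f, z = D'.c * w) ∧ (d = 2 ∨ d = -2) ∧
        2 ^ 2 ∣ A.conductorNorm ℤ ∧ A.conductorNorm ℤ ∣ 2 ^ 6 * N ∧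
        IsIsogenous W (A.quadraticTwist (d : ℚ)) ∧ u • A.quadraticTwist (d : ℚ) = C ∧
        C.Δ = (d : ℚ) ^ 6 * A.Δ ∧
        (A.minimalDiscriminantInt.natAbs < W.minimalDiscriminantInt.natAbs ∨
          (A.conductorNorm ℤ < N ∧ A.minimalDiscriminantInt.natAbs ≤ W.minimalDiscriminantInt.natAbs))) →
      ¬ (∃ (A : WeierstrassCurve ℚ) (_ : A.IsElliptic) (_ : A.IsGloballyMinimal)
        (D' : ModularParametrizationData A N) (q : ℕ) (C : WeierstrassCurve ℚ) (u : VariableChange ℚ),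
        C.IsElliptic ∧ C.IsGloballyMinimal ∧
        (∀ z ∈ D'.L.lattice, ∃ w ∈ periodLattice D'.f, z = D'.c * w) ∧ q.Prime ∧ q ≠ 2 ∧ q ^ 2 ∣ N ∧
        IsIsogenous C W ∧ u • A.quadraticTwist (((-1 : ℤ) ^ (q / 2) * q : ℤ) : ℚ) = C ∧
        C.Δ = ((((-1 : ℤ) ^ (q / 2) * q : ℤ)) : ℚ) ^ 6 * A.Δ ∧
        A.minimalDiscriminantInt.natAbs < W.minimalDiscriminantInt.natAbs) →
      ¬ (W.c₆ < 0 ∧ ∃ (A : WeierstrassCurve ℚ) (_ : A.IsElliptic) (_ : A.IsGloballyMinimal)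
        (D' : ModularParametrizationData A N),
        (∀ z ∈ D'.L.lattice, ∃ w ∈ periodLattice D'.f, z = D'.c * w) ∧ 2 ^ 4 ∣ N ∧
        2 ^ 2 ∣ A.conductorNorm ℤ ∧ IsIsogenous W (A.quadraticTwist ((-1 : ℤ) : ℚ)) ∧
        A.minimalDiscriminantInt.natAbs ≤ W.minimalDiscriminantInt.natAbs ∧ 0 < A.c₆) →
      W.HasIrreducibleModPGaloisRep 2 → ¬ IsSquare W.Δ → ¬ (4 : ℤ) ∣ D.c ∧ (W.Δ < 0 → ¬ (2 : ℤ) ∣ D.c))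
    (hRa : ∀ (W : WeierstrassCurve ℚ) [W.IsElliptic] [W.IsGloballyMinimal] {N : ℕ} [NeZero N]
      (D : ModularParametrizationData W N),
      (∀ z ∈ D.L.lattice, ∃ w ∈ periodLattice D.f, z = D.c * w) → 2 ^ 2 ∣ N →
      ¬ (∃ (W' : WeierstrassCurve ℚ) (d : ℤ), W'.IsElliptic ∧ W'.IsGloballyMinimal ∧
        (d = -1 ∨ d = 2 ∨ d = -2) ∧ IsIsogenous W (W'.quadraticTwist (d : ℚ)) ∧
        ¬ 2 ^ 2 ∣ W'.conductorNorm ℤ) →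
      ¬ (∃ (W' : WeierstrassCurve ℚ) (q : ℕ), W'.IsElliptic ∧ W'.IsGloballyMinimal ∧
        q.Prime ∧ q ≠ 2 ∧ q ^ 2 ∣ N ∧
        IsIsogenous W (W'.quadraticTwist (((-1 : ℤ) ^ (q / 2) * q : ℤ) : ℚ)) ∧
        ¬ q ^ 2 ∣ W'.conductorNorm ℤ) →
      ¬ (∃ (A : WeierstrassCurve ℚ) (_ : A.IsElliptic) (_ : A.IsGloballyMinimal) (N' : ℕ) (_ : NeZero N')
        (D' : ModularParametrizationData A N'),
        (∀ z ∈ D'.L.lattice, ∃ w ∈ periodLattice D'.f, z = D'.c * w) ∧ 2 ^ 4 ∣ N ∧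
        2 ^ 2 ∣ A.conductorNorm ℤ ∧ A.conductorNorm ℤ ∣ N ∧ A.conductorNorm ℤ < N ∧
        IsIsogenous W (A.quadraticTwist ((-1 : ℤ) : ℚ)) ∧
        A.minimalDiscriminantInt.natAbs ≤ W.minimalDiscriminantInt.natAbs) →
      ¬ (∃ (A : WeierstrassCurve ℚ) (_ : A.IsElliptic) (_ : A.IsGloballyMinimal) (N' : ℕ) (_ : NeZero N')
        (D' : ModularParametrizationData A N') (d : ℤ) (C : WeierstrassCurve ℚ) (u : VariableChange ℚ),
        C.IsElliptic ∧ C.IsGloballyMinimal ∧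
        (∀ z ∈ D'.L.lattice, ∃ w ∈ periodLattice D'.f, z = D'.c * w) ∧ (d = 2 ∨ d = -2) ∧
        2 ^ 2 ∣ A.conductorNorm ℤ ∧ A.conductorNorm ℤ ∣ 2 ^ 6 * N ∧
        IsIsogenous W (A.quadraticTwist (d : ℚ)) ∧ u • A.quadraticTwist (d : ℚ) = C ∧
        C.Δ = (d : ℚ) ^ 6 * A.Δ ∧
        (A.minimalDiscriminantInt.natAbs < W.minimalDiscriminantInt.natAbs ∨
          (A.conductorNorm ℤ < N ∧ A.minimalDiscriminantInt.natAbs ≤ W.minimalDiscriminantInt.natAbs))) →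
      ¬ (∃ (A : WeierstrassCurve ℚ) (_ : A.IsElliptic) (_ : A.IsGloballyMinimal)
        (D' : ModularParametrizationData A N) (q : ℕ) (C : WeierstrassCurve ℚ) (u : VariableChange ℚ),
        C.IsElliptic ∧ C.IsGloballyMinimal ∧
        (∀ z ∈ D'.L.lattice, ∃ w ∈ periodLattice D'.f, z = D'.c * w) ∧ q.Prime ∧ q ≠ 2 ∧ q ^ 2 ∣ N ∧
        IsIsogenous C W ∧ u • A.quadraticTwist (((-1 : ℤ) ^ (q / 2) * q : ℤ) : ℚ) = C ∧
        C.Δ = ((((-1 : ℤ) ^ (q / 2) * q : ℤ)) : ℚ) ^ 6 * A.Δ ∧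
        A.minimalDiscriminantInt.natAbs < W.minimalDiscriminantInt.natAbs) →
      ¬ (W.c₆ < 0 ∧ ∃ (A : WeierstrassCurve ℚ) (_ : A.IsElliptic) (_ : A.IsGloballyMinimal)
        (D' : ModularParametrizationData A N),
        (∀ z ∈ D'.L.lattice, ∃ w ∈ periodLattice D'.f, z = D'.c * w) ∧ 2 ^ 4 ∣ N ∧
        2 ^ 2 ∣ A.conductorNorm ℤ ∧ IsIsogenous W (A.quadraticTwist ((-1 : ℤ) : ℚ)) ∧
        A.minimalDiscriminantInt.natAbs ≤ W.minimalDiscriminantInt.natAbs ∧ 0 < A.c₆) →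
      W.HasIrreducibleModPGaloisRep 2 → ¬ IsSquare W.Δ → 0 < W.Δ → ¬ (4 : ℤ) ∣ D.c → ¬ (2 : ℤ) ∣ D.c)
    (hC3 : ∀ (W : WeierstrassCurve ℚ) [W.IsElliptic] [W.IsGloballyMinimal] {N : ℕ} [NeZero N]
      (D : ModularParametrizationData W N),
      (∀ z ∈ D.L.lattice, ∃ w ∈ periodLattice D.f, z = D.c * w) → 2 ^ 2 ∣ N →
      ¬ (∃ (W' : WeierstrassCurve ℚ) (d : ℤ), W'.IsElliptic ∧ W'.IsGloballyMinimal ∧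
        (d = -1 ∨ d = 2 ∨ d = -2) ∧ IsIsogenous W (W'.quadraticTwist (d : ℚ)) ∧
        ¬ 2 ^ 2 ∣ W'.conductorNorm ℤ) →
      ¬ (∃ (W' : WeierstrassCurve ℚ) (q : ℕ), W'.IsElliptic ∧ W'.IsGloballyMinimal ∧
        q.Prime ∧ q ≠ 2 ∧ q ^ 2 ∣ N ∧
        IsIsogenous W (W'.quadraticTwist (((-1 : ℤ) ^ (q / 2) * q : ℤ) : ℚ)) ∧
        ¬ q ^ 2 ∣ W'.conductorNorm ℤ) →
      ¬ (∃ (A : WeierstrassCurve ℚ) (_ : A.IsElliptic) (_ : A.IsGloballyMinimal) (N' : ℕ) (_ : NeZero N')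
        (D' : ModularParametrizationData A N'),
        (∀ z ∈ D'.L.lattice, ∃ w ∈ periodLattice D'.f, z = D'.c * w) ∧ 2 ^ 4 ∣ N ∧
        2 ^ 2 ∣ A.conductorNorm ℤ ∧ A.conductorNorm ℤ ∣ N ∧ A.conductorNorm ℤ < N ∧
        IsIsogenous W (A.quadraticTwist ((-1 : ℤ) : ℚ)) ∧
        A.minimalDiscriminantInt.natAbs ≤ W.minimalDiscriminantInt.natAbs) →
      ¬ (∃ (A : WeierstrassCurve ℚ) (_ : A.IsElliptic) (_ : A.IsGloballyMinimal) (N' : ℕ) (_ : NeZero N')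
        (D' : ModularParametrizationData A N') (d : ℤ) (C : WeierstrassCurve ℚ) (u : VariableChange ℚ),
        C.IsElliptic ∧ C.IsGloballyMinimal ∧
        (∀ z ∈ D'.L.lattice, ∃ w ∈ periodLattice D'.f, z = D'.c * w) ∧ (d = 2 ∨ d = -2) ∧
        2 ^ 2 ∣ A.conductorNorm ℤ ∧ A.conductorNorm ℤ ∣ 2 ^ 6 * N ∧
        IsIsogenous W (A.quadraticTwist (d : ℚ)) ∧ u • A.quadraticTwist (d : ℚ) = C ∧
        C.Δ = (d : ℚ) ^ 6 * A.Δ ∧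
        (A.minimalDiscriminantInt.natAbs < W.minimalDiscriminantInt.natAbs ∨
          (A.conductorNorm ℤ < N ∧ A.minimalDiscriminantInt.natAbs ≤ W.minimalDiscriminantInt.natAbs))) →
      ¬ (∃ (A : WeierstrassCurve ℚ) (_ : A.IsElliptic) (_ : A.IsGloballyMinimal)
        (D' : ModularParametrizationData A N) (q : ℕ) (C : WeierstrassCurve ℚ) (u : VariableChange ℚ),
        C.IsElliptic ∧ C.IsGloballyMinimal ∧
        (∀ z ∈ D'.L.lattice, ∃ w ∈ periodLattice D'.f, z = D'.c * w) ∧ q.Prime ∧ q ≠ 2 ∧ q ^ 2 ∣ N ∧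
        IsIsogenous C W ∧ u • A.quadraticTwist (((-1 : ℤ) ^ (q / 2) * q : ℤ) : ℚ) = C ∧
        C.Δ = ((((-1 : ℤ) ^ (q / 2) * q : ℤ)) : ℚ) ^ 6 * A.Δ ∧
        A.minimalDiscriminantInt.natAbs < W.minimalDiscriminantInt.natAbs) →
      ¬ (W.c₆ < 0 ∧ ∃ (A : WeierstrassCurve ℚ) (_ : A.IsElliptic) (_ : A.IsGloballyMinimal)
        (D' : ModularParametrizationData A N),
        (∀ z ∈ D'.L.lattice, ∃ w ∈ periodLattice D'.f, z = D'.c * w) ∧ 2 ^ 4 ∣ N ∧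
        2 ^ 2 ∣ A.conductorNorm ℤ ∧ IsIsogenous W (A.quadraticTwist ((-1 : ℤ) : ℚ)) ∧
        A.minimalDiscriminantInt.natAbs ≤ W.minimalDiscriminantInt.natAbs ∧ 0 < A.c₆) →
      W.HasIrreducibleModPGaloisRep 2 → IsSquare W.Δ → ¬ (2 : ℤ) ∣ D.c)
    (hRb : ∀ (W : WeierstrassCurve ℚ) [W.IsElliptic] [W.IsGloballyMinimal] {N : ℕ} [NeZero N]
      (D : ModularParametrizationData W N),
      (∀ z ∈ D.L.lattice, ∃ w ∈ periodLattice D.f, z = D.c * w) → 2 ^ 2 ∣ N →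
      ¬ (∃ (W' : WeierstrassCurve ℚ) (d : ℤ), W'.IsElliptic ∧ W'.IsGloballyMinimal ∧
        (d = -1 ∨ d = 2 ∨ d = -2) ∧ IsIsogenous W (W'.quadraticTwist (d : ℚ)) ∧
        ¬ 2 ^ 2 ∣ W'.conductorNorm ℤ) →
      ¬ (∃ (W' : WeierstrassCurve ℚ) (q : ℕ), W'.IsElliptic ∧ W'.IsGloballyMinimal ∧
        q.Prime ∧ q ≠ 2 ∧ q ^ 2 ∣ N ∧
        IsIsogenous W (W'.quadraticTwist (((-1 : ℤ) ^ (q / 2) * q : ℤ) : ℚ)) ∧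
        ¬ q ^ 2 ∣ W'.conductorNorm ℤ) →
      ¬ (∃ (A : WeierstrassCurve ℚ) (_ : A.IsElliptic) (_ : A.IsGloballyMinimal) (N' : ℕ) (_ : NeZero N')
        (D' : ModularParametrizationData A N'),
        (∀ z ∈ D'.L.lattice, ∃ w ∈ periodLattice D'.f, z = D'.c * w) ∧ 2 ^ 4 ∣ N ∧
        2 ^ 2 ∣ A.conductorNorm ℤ ∧ A.conductorNorm ℤ ∣ N ∧ A.conductorNorm ℤ < N ∧
        IsIsogenous W (A.quadraticTwist ((-1 : ℤ) : ℚ)) ∧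
        A.minimalDiscriminantInt.natAbs ≤ W.minimalDiscriminantInt.natAbs) →
      ¬ (∃ (A : WeierstrassCurve ℚ) (_ : A.IsElliptic) (_ : A.IsGloballyMinimal) (N' : ℕ) (_ : NeZero N')
        (D' : ModularParametrizationData A N') (d : ℤ) (C : WeierstrassCurve ℚ) (u : VariableChange ℚ),
        C.IsElliptic ∧ C.IsGloballyMinimal ∧
        (∀ z ∈ D'.L.lattice, ∃ w ∈ periodLattice D'.f, z = D'.c * w) ∧ (d = 2 ∨ d = -2) ∧
        2 ^ 2 ∣ A.conductorNorm ℤ ∧ A.conductorNorm ℤ ∣ 2 ^ 6 * N ∧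
        IsIsogenous W (A.quadraticTwist (d : ℚ)) ∧ u • A.quadraticTwist (d : ℚ) = C ∧
        C.Δ = (d : ℚ) ^ 6 * A.Δ ∧
        (A.minimalDiscriminantInt.natAbs < W.minimalDiscriminantInt.natAbs ∨
          (A.conductorNorm ℤ < N ∧ A.minimalDiscriminantInt.natAbs ≤ W.minimalDiscriminantInt.natAbs))) →
      ¬ (∃ (A : WeierstrassCurve ℚ) (_ : A.IsElliptic) (_ : A.IsGloballyMinimal)
        (D' : ModularParametrizationData A N) (q : ℕ) (C : WeierstrassCurve ℚ) (u : VariableChange ℚ),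
        C.IsElliptic ∧ C.IsGloballyMinimal ∧
        (∀ z ∈ D'.L.lattice, ∃ w ∈ periodLattice D'.f, z = D'.c * w) ∧ q.Prime ∧ q ≠ 2 ∧ q ^ 2 ∣ N ∧
        IsIsogenous C W ∧ u • A.quadraticTwist (((-1 : ℤ) ^ (q / 2) * q : ℤ) : ℚ) = C ∧
        C.Δ = ((((-1 : ℤ) ^ (q / 2) * q : ℤ)) : ℚ) ^ 6 * A.Δ ∧
        A.minimalDiscriminantInt.natAbs < W.minimalDiscriminantInt.natAbs) →
      ¬ (W.c₆ < 0 ∧ ∃ (A : WeierstrassCurve ℚ) (_ : A.IsElliptic) (_ : A.IsGloballyMinimal)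
        (D' : ModularParametrizationData A N),
        (∀ z ∈ D'.L.lattice, ∃ w ∈ periodLattice D'.f, z = D'.c * w) ∧ 2 ^ 4 ∣ N ∧
        2 ^ 2 ∣ A.conductorNorm ℤ ∧ IsIsogenous W (A.quadraticTwist ((-1 : ℤ) : ℚ)) ∧
        A.minimalDiscriminantInt.natAbs ≤ W.minimalDiscriminantInt.natAbs ∧ 0 < A.c₆) →
      ¬ W.HasIrreducibleModPGaloisRep 2 → ¬ (2 : ℤ) ∣ D.c)
 :
    Summit.BirchSwinnertonDyer.BirchSwinnertonDyer.Theses.ManinLocalTwoThree.ManinOddAtFour :=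
  maninLocalTwoThree_maninOddAtFour_of_discLevelMinimal
    (fun _hM _hAU _hC _hnf W _ _ N _ D hopt h4 h1 h2 h3 h5 h6 h7 => by
      show ¬ (2 : ℤ) ∣ D.c
      by_cases hirr : W.HasIrreducibleModPGaloisRep 2
      · by_cases hsq : IsSquare W.Δ
        · exact hC3 W D hopt h4 h1 h2 h3 h5 h6 h7 hirr hsq
        · obtain ⟨h4c, hneg⟩ := hS3 W D hopt h4 h1 h2 h3 h5 h6 h7 hirr hsq
          rcases lt_trichotomy W.Δ 0 with hlt | heq | hgt
          · exact hneg hlt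
          · exact absurd heq W.isUnit_Δ.ne_zero
          · exact hRa W D hopt h4 h1 h2 h3 h5 h6 h7 hirr hsq hgt h4c
      · exact hRb W D hopt h4 h1 h2 h3 h5 h6 h7 hirr)

/-- **The `C₃`-image classes have positive discriminant**: a rational square is `≥ 0` and `Δ ≠ 0`; so the `C₃` residual
lies inside the archimedean (`Δ > 0`) territory of the line. [elementary] -/
theorem maninLocalTwoThree_Δ_pos_of_isSquare (W : WeierstrassCurve ℚ) [W.IsElliptic] (h : IsSquare W.Δ) : 0 < W.Δ := by
  obtain ⟨r, hr⟩ := h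
  rcases lt_or_eq_of_le (hr ▸ mul_self_nonneg r : (0 : ℚ) ≤ W.Δ) with hpos | hzero
  · exact hpos
  · exact absurd hzero.symm W.isUnit_Δ.ne_zero

end Summit.BirchSwinnertonDyer.BirchSwinnertonDyer.Theorems

end
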